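import Summits.BirchSwinnertonDyer.BirchSwinnertonDyer.Theorems.BiquadraticEisensteinDescentHeegnerTwistCouplingInSupplyPartnerLadderRungs
import Summits.BirchSwinnertonDyer.BirchSwinnertonDyer.Theorems.BiquadraticEisensteinDescentHeegnerTwistCouplingInSupplyCornersE2pFourFacts
import HarnessLib

set_option linter.dupNamespace false -- `Summit.BirchSwinnertonDyer.BirchSwinnertonDyer.Theorems.…` (summit = sub)
set_option autoImplicit false

/-!
# Crux `HeegnerTwistCouplingInSupply` (stmt-BirchSwinnertonDyer-21381) — the corner `W = E_p`, `p ≡ 7 (mod 8)` (partners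
# `{3, 5, 11, 13, 19, 43}`, `63/64` of the family) modulo FOUR named facts: the Deuring–Hecke leaf is discharged

Route `BiquadraticEisensteinDescent` (cell `pub/bsd-wall`, width seat `bsd-wall-cm-bed-w4` g12; `--supports` 21381, helper). Sequel to
`…CornersE2pFourFacts` (the three-fact journal doors `analyticRank_eq_zero_of_det_odd_fourFacts`, from the Literature doors
`HeathBrown1994.bsdTriple_of_monsky_of_BT_BF_odd_congruent`, p653095: `L(E_n, s)` entire is the tree theorem
`hasEntireLFunction_congruentNumberCurve_holds`) and to `…PartnerLadder[Rungs]` (p652137/p652497: generic rungs, kernel tables).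
One assembler `corner_p_of_cell` (row-1 Monsky cell `{p ≡ 7; q ≡ 3; ℓ ≡ 5 (mod 8)}`, `(q/p) = +1`, `(ℓ/p) = −1`, field `ℚ(√−qℓ)`,
a class-number certificate) and thin wrappers: partner `3` (three-squares pin, p645024's `CruxOnEpCornerMod24`), partner `5`
(p649700's cell A), the generic q-side / ℓ-side rungs with their table forms, the rungs `11, 19, 43, 13`, and

★ `cruxOnEpCornerLadder_of_four_facts` — **for every prime `p ≡ 7 (mod 8)` with `p ≡ 2 (3) ∨ p ≡ ±2 (5) ∨ (p/11) = −1 ∨ (p/19) = −1 ∨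
(p/43) = −1 ∨ (13/p) = −1`: a Heegner field `K′` of `N(E_p)` with `4 < |d_{K′}|`, `L(E_p^{(d_{K′})}, 1) ≠ 0`, `h(K′) < p`, `p ∤ h(K′)`,
modulo Modularity (for `N(E_p) = 32p²` only) + Monsky (odd) + Burungale–Tian + Burungale–Flach** — p652497's union with one named
fact fewer.

HONEST FRAMING: typed sub-corner rungs of the crux's CONCLUSION on one CM family (residual density `1/64` of `p ≡ 7 (mod 8)`; never all
`p` by pinned cells); the crux (all CM `W` of analytic rank one; residual C⁺) is untouched; BSD is not proved by any of this. THEOREMS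
ONLY. Supports stmt-BirchSwinnertonDyer-21381.
-/

namespace Summit.BirchSwinnertonDyer.BirchSwinnertonDyer.Theorems.BiquadraticEisensteinDescentHeegnerTwistCouplingInSupplyCornersEpFourFacts

open Literature.NumberTheory.EllipticCurves Literature.NumberTheory.EllipticCurves.HeathBrown1994
  Literature.NumberTheory.EllipticCurves.HeathBrown1994.Families
  Literature.NumberTheory.QuadraticFields Literature.NumberTheory.QuadraticFields.Quadratic
  Summit.BirchSwinnertonDyer.BirchSwinnertonDyer.Theorems.BiquadraticEisensteinDescentHeegnerTwistCouplingInSupplyThreeSquaresPin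
  Summit.BirchSwinnertonDyer.BirchSwinnertonDyer.Theorems.BiquadraticEisensteinDescentHeegnerTwistCouplingInSupplyMonskyCells
  Summit.BirchSwinnertonDyer.BirchSwinnertonDyer.Theorems.BiquadraticEisensteinDescentHeegnerTwistCouplingInSupplyThreeSquaresPinRankZero
  Summit.BirchSwinnertonDyer.BirchSwinnertonDyer.Theorems.BiquadraticEisensteinDescentHeegnerTwistCouplingInSupplySizeIndivisibleSharp
  Summit.BirchSwinnertonDyer.BirchSwinnertonDyer.Theorems.BiquadraticEisensteinDescentHeegnerTwistCouplingInSupplyThreeSquaresPinCorner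
  Summit.BirchSwinnertonDyer.BirchSwinnertonDyer.Theorems.BiquadraticEisensteinDescentHeegnerTwistCouplingInSupplyIndefinitePin
  Summit.BirchSwinnertonDyer.BirchSwinnertonDyer.Theorems.BiquadraticEisensteinDescentHeegnerTwistCouplingInSupplyPartnerTables
  Summit.BirchSwinnertonDyer.BirchSwinnertonDyer.Theorems.BiquadraticEisensteinDescentHeegnerTwistCouplingInSupplyIndefinitePinWitness
  Summit.BirchSwinnertonDyer.BirchSwinnertonDyer.Theorems.BiquadraticEisensteinDescentHeegnerTwistCouplingInSupplyPartnerLadder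
  Summit.BirchSwinnertonDyer.BirchSwinnertonDyer.Theorems.BiquadraticEisensteinDescentHeegnerTwistCouplingInSupplyPartnerLadderRungs
  Summit.BirchSwinnertonDyer.BirchSwinnertonDyer.Theorems.BiquadraticEisensteinDescentHeegnerTwistCouplingInSupplyCornersE2pFourFacts

/-! ## §1 The assembler: one row-1 cell with a class-number certificate ⟹ the corner conclusion for `E_p` -/

/-- **Row-1 cell assembler, four facts.** `p ≡ 7 (mod 8)` prime, `q ≡ 3`, `ℓ ≡ 5 (mod 8)` primes with `(q/p) = +1`, `(ℓ/p) = −1`,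
and `h(K) < p` for every imaginary quadratic `K` of discriminant `−qℓ` ⟹ the Heegner field `K′ = ℚ(√−qℓ)` of `N(E_p) = 32p²` with
`4 < |d_{K′}|`, `L(E_p^{(−qℓ)}, 1) ≠ 0`, `h(K′) < p`, `p ∤ h(K′)` — modulo Modularity (conductor) + Monsky (odd) + Burungale–Tian +
Burungale–Flach. [cite: HeathBrown1994SelmerCongruentII, Appendix (Monsky), typescript p. 39 L27–L33] [cite: BurungaleTian2026, Thm. 1.1]
[cite: BurungaleFlach2024, Thm. 1.1 and Cor. 2] [cite: Marcus2018, Ch. 3 Thm. 25] -/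
theorem corner_p_of_cell (hmod : ModularForms.exists_isNewformOf) (hM : monsky_card_selmerGroup_two_odd)
    (hBT : burungaleTian_analyticRank_eq_zero_of_selmerCorank_eq_zero_of_hasCM) (hBF : bsdTriple_of_hasCM_of_L_one_ne_zero)
    {p q l : ℕ} [Fact p.Prime] [(congruentNumberCurve p).IsElliptic] [(congruentNumberCurve p).IsGloballyMinimal]
    [NeZero ((congruentNumberCurve p).conductorNorm ℤ)] (hp8 : p % 8 = 7) (hq : q.Prime) (hq8 : q % 8 = 3) (hl : l.Prime)
    (hl8 : l % 8 = 5) (hJq : jacobiSym (q : ℤ) p = 1) (hJl : jacobiSym (l : ℤ) p = -1)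
    (hh : ∀ (K : Type) [Field K] [NumberField K], IsImaginaryQuadratic K →
      NumberField.discr K = -((q * l : ℕ) : ℤ) → NumberField.classNumber K < p) :
    ∃ (K : Type) (_ : Field K) (_ : NumberField K),
      IsImaginaryQuadratic K ∧ 4 < (NumberField.discr K).natAbs ∧
      SatisfiesHeegnerHypothesis ((congruentNumberCurve p).conductorNorm ℤ) K ∧
      ((congruentNumberCurve p).quadraticTwist (NumberField.discr K : ℚ)).entireLFunction 1 ≠ 0 ∧
      NumberField.classNumber K < p ∧ ¬ p ∣ NumberField.classNumber K := by
  have hp : p.Prime := Fact.out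
  have hp4 : p % 4 = 3 := by omega
  have hqp : q ≠ p := ne_of_jacobiSym_ne_zero hp (by rw [hJq]; norm_num)
  have hlp : l ≠ p := ne_of_jacobiSym_ne_zero hp (by rw [hJl]; norm_num)
  have hdet := det_monskyMatrixOdd_cell_seven_mod_eight (p := p) hp hq hl hp8 hq8 hl8 hJl
  obtain ⟨-, -, -, hL⟩ := analyticRank_eq_zero_of_det_odd_fourFacts hM hBT hBF hp hq hl (by omega) (by omega) (by omega)
    (Ne.symm hqp) (Ne.symm hlp) (by rintro rfl; omega) hdet
  have hN : (congruentNumberCurve p).conductorNorm ℤ = 32 * p ^ 2 :=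
    conductorNorm_congruentNumberCurve_of_odd hmod hp.squarefree (Nat.odd_iff.mpr (by omega))
  obtain ⟨K, iF, iN, hK, hdK, hH', hcl⟩ := exists_witnessField_of (N := (congruentNumberCurve p).conductorNorm ℤ)
    hq hq8 hl hl8 (jacobiSym_neg_mul_eq_one hp4 hJq hJl) hh
    (fun r hr hrN => eq_two_or_eq_of_prime_dvd_thirtyTwo_mul_sq hp hr (hN ▸ hrN))
  refine ⟨K, iF, iN, hK, ?_, hH', ?_, hcl, fun hdvd =>
    absurd (Nat.le_of_dvd (NumberField.classNumber_pos K) hdvd) (not_le.mpr hcl)⟩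
  · rw [hdK, Int.natAbs_neg, Int.natAbs_natCast]
    have h2 : 2 ≤ q := hq.two_le
    have h5 : 5 ≤ l := by have := hl.two_le; omega
    calc 4 < 2 * 5 := by norm_num
      _ ≤ q * l := Nat.mul_le_mul h2 h5
  · rw [hdK, quadraticTwist_congruentNumberCurve, Int.natAbs_neg, Int.natAbs_natCast]
    exact hL

/-! ## §2 Partners `3` and `5` (the tree's corners, four facts) -/

/-- **Partner `3`, `p ≡ 23 (mod 24)`** (p645024's `CruxOnEpCornerMod24`, four facts): `(3/p) = +1`, three-squares pin `ℓ < 2p`,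
`K′ = ℚ(√−3ℓ)`, `|d| < 6p` ⇒ `h(K′) < p`. [cite: HeathBrown1994SelmerCongruentII, Appendix (Monsky), typescript p. 39 L27–L33]
[cite: Oesterle1988Gauss, II §3 Proposition p. 57 (27)] -/
theorem corner_p_three (hmod : ModularForms.exists_isNewformOf) (hM : monsky_card_selmerGroup_two_odd)
    (hBT : burungaleTian_analyticRank_eq_zero_of_selmerCorank_eq_zero_of_hasCM) (hBF : bsdTriple_of_hasCM_of_L_one_ne_zero)
    {p : ℕ} [Fact p.Prime] [(congruentNumberCurve p).IsElliptic] [(congruentNumberCurve p).IsGloballyMinimal]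
    [NeZero ((congruentNumberCurve p).conductorNorm ℤ)] (hp24 : p % 24 = 23) :
    ∃ (K : Type) (_ : Field K) (_ : NumberField K),
      IsImaginaryQuadratic K ∧ 4 < (NumberField.discr K).natAbs ∧
      SatisfiesHeegnerHypothesis ((congruentNumberCurve p).conductorNorm ℤ) K ∧
      ((congruentNumberCurve p).quadraticTwist (NumberField.discr K : ℚ)).entireLFunction 1 ≠ 0 ∧
      NumberField.classNumber K < p ∧ ¬ p ∣ NumberField.classNumber K := by
  have hp : p.Prime := Fact.out
  obtain ⟨ℓ, hℓ, hlt, hℓ8, hJ⟩ := threeSquaresPin p hp (by omega)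
  refine corner_p_of_cell hmod hM hBT hBF (by omega) Nat.prime_three (by norm_num) hℓ hℓ8
    (by exact_mod_cast jacobiSym_three_eq_one (p := p) (by omega)) hJ fun K _ _ hK hdK => ?_
  refine classNumber_lt_of_natAbs_discr_lt_six_mul hK ?_ (by omega) ?_
  · rw [hdK, Int.natAbs_neg, Int.natAbs_natCast]
    have := hℓ.two_le
    omega
  · rw [hdK, Int.natAbs_neg, Int.natAbs_natCast]
    omega

/-- **Partner `5`, `p ≡ 7 (mod 8)`, `p ≡ ±2 (mod 5)`** (p649700's cell A, four facts): `(5/p) = −1`, a `(3,+)` partner `q` with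
`h(ℚ(√−5q)) < p` (table below `800`, indefinite pin above). [cite: HeathBrown1994SelmerCongruentII, Appendix (Monsky), typescript p. 39 L27–L33]
[cite: Oesterle1988Gauss, II §3 Proposition p. 57 (27)] -/
theorem corner_p_five (hmod : ModularForms.exists_isNewformOf) (hM : monsky_card_selmerGroup_two_odd)
    (hBT : burungaleTian_analyticRank_eq_zero_of_selmerCorank_eq_zero_of_hasCM) (hBF : bsdTriple_of_hasCM_of_L_one_ne_zero)
    {p : ℕ} [Fact p.Prime] [(congruentNumberCurve p).IsElliptic] [(congruentNumberCurve p).IsGloballyMinimal]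
    [NeZero ((congruentNumberCurve p).conductorNorm ℤ)] (hp8 : p % 8 = 7) (hp5 : p % 5 = 2 ∨ p % 5 = 3) :
    ∃ (K : Type) (_ : Field K) (_ : NumberField K),
      IsImaginaryQuadratic K ∧ 4 < (NumberField.discr K).natAbs ∧
      SatisfiesHeegnerHypothesis ((congruentNumberCurve p).conductorNorm ℤ) K ∧
      ((congruentNumberCurve p).quadraticTwist (NumberField.discr K : ℚ)).entireLFunction 1 ≠ 0 ∧
      NumberField.classNumber K < p ∧ ¬ p ∣ NumberField.classNumber K := by
  have hp : p.Prime := Fact.out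
  obtain ⟨q, hq, hq8, hJ, hh⟩ := exists_threePlus_classNumber_lt hp (by omega) hp5 (by omega)
  refine corner_p_of_cell hmod hM hBT hBF hp8 hq hq8 Nat.prime_five (by norm_num) hJ
    (by exact_mod_cast jacobiSym_five_eq_neg_one (p := p) (by omega) hp5) fun K _ _ hK hdK => hh K hK ?_
  rw [hdK, Nat.mul_comm]

/-! ## §3 The generic rungs, four facts -/

/-- **Generic q-side rung, four facts** (`…PartnerLadder.cruxOnEpCornerPartnerQ_of_facts` without Deuring–Hecke).
[cite: HeathBrown1994SelmerCongruentII, Appendix (Monsky), typescript p. 39 L27–L33] [cite: Oesterle1988Gauss, II §3 Proposition p. 57 (27)] -/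
theorem corner_p_partnerQ (hmod : ModularForms.exists_isNewformOf) (hM : monsky_card_selmerGroup_two_odd)
    (hBT : burungaleTian_analyticRank_eq_zero_of_selmerCorank_eq_zero_of_hasCM) (hBF : bsdTriple_of_hasCM_of_L_one_ne_zero)
    {p : ℕ} [Fact p.Prime] [(congruentNumberCurve p).IsElliptic] [(congruentNumberCurve p).IsGloballyMinimal]
    [NeZero ((congruentNumberCurve p).conductorNorm ℤ)] {q₀ : ℕ} (hq₀ : q₀.Prime) (hq₀8 : q₀ % 8 = 3) {P : ℕ}
    (hkey : (8 : ℝ) ^ 8 * ((2 * q₀ : ℕ) : ℝ) ^ 5 ≤ (2.718 * 3.1415) ^ 8 * (P : ℝ) ^ 3)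
    (hp8 : p % 8 = 7) (hJq : jacobiSym (p : ℤ) q₀ = -1) (hPp : P ≤ p) :
    ∃ (K : Type) (_ : Field K) (_ : NumberField K),
      IsImaginaryQuadratic K ∧ 4 < (NumberField.discr K).natAbs ∧
      SatisfiesHeegnerHypothesis ((congruentNumberCurve p).conductorNorm ℤ) K ∧
      ((congruentNumberCurve p).quadraticTwist (NumberField.discr K : ℚ)).entireLFunction 1 ≠ 0 ∧
      NumberField.classNumber K < p ∧ ¬ p ∣ NumberField.classNumber K := by
  have hp : p.Prime := Fact.out
  obtain ⟨ℓ, hℓ, hℓlt, hℓ8, hJℓ⟩ := threeSquaresPin p hp (by omega)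
  have hxc : ((q₀ * ℓ : ℕ) : ℝ) < ((2 * q₀ : ℕ) : ℝ) * p := by
    have h1 : q₀ * ℓ < 2 * q₀ * p := by
      have := hq₀.pos
      nlinarith
    exact_mod_cast h1
  exact corner_p_of_cell hmod hM hBT hBF hp8 hq₀ hq₀8 hℓ hℓ8
    (jacobiSym_eq_one_of_jacobiSym_eq_neg_one (by omega) (by omega) hJq) hJℓ (classNumber_lt_of_lever hq₀ hℓ hℓ8 hxc hkey hPp)

/-- **q-side rung from a table row, four facts.** [cite: Cox2013, §2.A Thm. 2.13] [cite: HeathBrown1994SelmerCongruentII, Appendix (Monsky), typescript p. 39 L27–L33] -/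
theorem corner_p_partnerQ_row (hmod : ModularForms.exists_isNewformOf) (hM : monsky_card_selmerGroup_two_odd)
    (hBT : burungaleTian_analyticRank_eq_zero_of_selmerCorank_eq_zero_of_hasCM) (hBF : bsdTriple_of_hasCM_of_L_one_ne_zero)
    {p : ℕ} [Fact p.Prime] [(congruentNumberCurve p).IsElliptic] [(congruentNumberCurve p).IsGloballyMinimal]
    [NeZero ((congruentNumberCurve p).conductorNorm ℤ)] {q₀ : ℕ} (hq₀ : q₀.Prime) (hq₀8 : q₀ % 8 = 3) (hp8 : p % 8 = 7)
    (hJq : jacobiSym (p : ℤ) q₀ = -1) {ℓ : ℕ} (hℓ : ℓ.Prime) (hℓ8 : ℓ % 8 = 5) (hres : ∀ x < ℓ, x * x % ℓ ≠ p % ℓ)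
    (hh : BinQF.classNumberCount (q₀ * ℓ) < p) :
    ∃ (K : Type) (_ : Field K) (_ : NumberField K),
      IsImaginaryQuadratic K ∧ 4 < (NumberField.discr K).natAbs ∧
      SatisfiesHeegnerHypothesis ((congruentNumberCurve p).conductorNorm ℤ) K ∧
      ((congruentNumberCurve p).quadraticTwist (NumberField.discr K : ℚ)).entireLFunction 1 ≠ 0 ∧
      NumberField.classNumber K < p ∧ ¬ p ∣ NumberField.classNumber K :=
  corner_p_of_cell hmod hM hBT hBF hp8 hq₀ hq₀8 hℓ hℓ8 (jacobiSym_eq_one_of_jacobiSym_eq_neg_one (by omega) (by omega) hJq)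
    (jacobiSym_eq_neg_one_of_table_one_mod_four hℓ (by omega) (by omega) hres) (classNumber_lt_of_count hq₀ hℓ hh)

/-- **Generic ℓ-side rung, four facts** (`…PartnerLadder.cruxOnEpCornerPartnerL_of_facts` without Deuring–Hecke).
[cite: HeathBrown1994SelmerCongruentII, Appendix (Monsky), typescript p. 39 L27–L33] [cite: Oesterle1988Gauss, II §3 Proposition p. 57 (27)] -/
theorem corner_p_partnerL (hmod : ModularForms.exists_isNewformOf) (hM : monsky_card_selmerGroup_two_odd)
    (hBT : burungaleTian_analyticRank_eq_zero_of_selmerCorank_eq_zero_of_hasCM) (hBF : bsdTriple_of_hasCM_of_L_one_ne_zero)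
    {p : ℕ} [Fact p.Prime] [(congruentNumberCurve p).IsElliptic] [(congruentNumberCurve p).IsGloballyMinimal]
    [NeZero ((congruentNumberCurve p).conductorNorm ℤ)] {ℓ₀ : ℕ} (hℓ₀ : ℓ₀.Prime) (hℓ₀8 : ℓ₀ % 8 = 5) {P : ℕ} (hP800 : 800 ≤ P)
    (hkey : (8 : ℝ) ^ 8 * ((10 * ℓ₀ : ℕ) : ℝ) ^ 5 ≤ (2.718 * 3.1415) ^ 8 * (P : ℝ) ^ 3)
    (hp8 : p % 8 = 7) (hJℓ : jacobiSym (ℓ₀ : ℤ) p = -1) (hPp : P ≤ p) :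
    ∃ (K : Type) (_ : Field K) (_ : NumberField K),
      IsImaginaryQuadratic K ∧ 4 < (NumberField.discr K).natAbs ∧
      SatisfiesHeegnerHypothesis ((congruentNumberCurve p).conductorNorm ℤ) K ∧
      ((congruentNumberCurve p).quadraticTwist (NumberField.discr K : ℚ)).entireLFunction 1 ≠ 0 ∧
      NumberField.classNumber K < p ∧ ¬ p ∣ NumberField.classNumber K := by
  have hp : p.Prime := Fact.out
  obtain ⟨q, hq, hq8, hJq, hqle⟩ := indefinitePinThreePlus hp (by omega) (hP800.trans hPp)
  have hxc : ((q * ℓ₀ : ℕ) : ℝ) < ((10 * ℓ₀ : ℕ) : ℝ) * p := by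
    have hqlt : q < 10 * p := by
      rcases hqle.lt_or_eq with h | h
      · exact h
      · exfalso; omega
    have h1 : q * ℓ₀ < 10 * ℓ₀ * p := by
      have := hℓ₀.pos
      nlinarith
    exact_mod_cast h1
  exact corner_p_of_cell hmod hM hBT hBF hp8 hq hq8 hℓ₀ hℓ₀8 hJq hJℓ (classNumber_lt_of_lever hq hℓ₀ hℓ₀8 hxc hkey hPp)

/-- **ℓ-side rung from a table row, four facts.** [cite: Cox2013, §2.A Thm. 2.13] [cite: HeathBrown1994SelmerCongruentII, Appendix (Monsky), typescript p. 39 L27–L33] -/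
theorem corner_p_partnerL_row (hmod : ModularForms.exists_isNewformOf) (hM : monsky_card_selmerGroup_two_odd)
    (hBT : burungaleTian_analyticRank_eq_zero_of_selmerCorank_eq_zero_of_hasCM) (hBF : bsdTriple_of_hasCM_of_L_one_ne_zero)
    {p : ℕ} [Fact p.Prime] [(congruentNumberCurve p).IsElliptic] [(congruentNumberCurve p).IsGloballyMinimal]
    [NeZero ((congruentNumberCurve p).conductorNorm ℤ)] {ℓ₀ : ℕ} (hℓ₀ : ℓ₀.Prime) (hℓ₀8 : ℓ₀ % 8 = 5) (hp8 : p % 8 = 7)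
    (hJℓ : jacobiSym (ℓ₀ : ℤ) p = -1) {q : ℕ} (hq : q.Prime) (hq8 : q % 8 = 3) (hres : ∀ x < q, x * x % q ≠ p % q)
    (hh : BinQF.classNumberCount (q * ℓ₀) < p) :
    ∃ (K : Type) (_ : Field K) (_ : NumberField K),
      IsImaginaryQuadratic K ∧ 4 < (NumberField.discr K).natAbs ∧
      SatisfiesHeegnerHypothesis ((congruentNumberCurve p).conductorNorm ℤ) K ∧
      ((congruentNumberCurve p).quadraticTwist (NumberField.discr K : ℚ)).entireLFunction 1 ≠ 0 ∧
      NumberField.classNumber K < p ∧ ¬ p ∣ NumberField.classNumber K :=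
  corner_p_of_cell hmod hM hBT hBF hp8 hq hq8 hℓ₀ hℓ₀8 (jacobiSym_eq_one_of_table hq (by omega) hq8 hres) hJℓ
    (classNumber_lt_of_count hq hℓ₀ hh)

/-! ## §4 The rungs `11, 19, 43, 13` and the union, four facts -/

/-- **Rung `q₀ = 11`, four facts.** [cite: HeathBrown1994SelmerCongruentII, Appendix (Monsky), typescript p. 39 L27–L33] [cite: Cohen1993, §5.3.1 Algorithm 5.3.5] -/
theorem corner_p_eleven (hmod : ModularForms.exists_isNewformOf) (hM : monsky_card_selmerGroup_two_odd)
    (hBT : burungaleTian_analyticRank_eq_zero_of_selmerCorank_eq_zero_of_hasCM) (hBF : bsdTriple_of_hasCM_of_L_one_ne_zero)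
    {p : ℕ} [Fact p.Prime] [(congruentNumberCurve p).IsElliptic] [(congruentNumberCurve p).IsGloballyMinimal]
    [NeZero ((congruentNumberCurve p).conductorNorm ℤ)] (hp8 : p % 8 = 7) (hJ : jacobiSym (p : ℤ) 11 = -1) :
    ∃ (K : Type) (_ : Field K) (_ : NumberField K),
      IsImaginaryQuadratic K ∧ 4 < (NumberField.discr K).natAbs ∧
      SatisfiesHeegnerHypothesis ((congruentNumberCurve p).conductorNorm ℤ) K ∧
      ((congruentNumberCurve p).quadraticTwist (NumberField.discr K : ℚ)).entireLFunction 1 ≠ 0 ∧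
      NumberField.classNumber K < p ∧ ¬ p ∣ NumberField.classNumber K := by
  rcases Nat.lt_or_ge p 146 with hlt | hge
  · obtain ⟨l, hlmem, -, hres, hh⟩ :=
      tableQ11 p (Finset.mem_range.mpr hlt) hp8 (forall_sq_ne_of_jacobiSym_eq_neg_one hJ)
    obtain ⟨hl, hl8⟩ := partnersL_spec l hlmem
    exact corner_p_partnerQ_row hmod hM hBT hBF (by norm_num) (by norm_num) hp8 hJ hl hl8 hres hh
  · exact corner_p_partnerQ hmod hM hBT hBF (q₀ := 11) (by norm_num) (by norm_num) (P := 146) (by norm_num) hp8 hJ hge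

/-- **Rung `q₀ = 19`, four facts.** [cite: HeathBrown1994SelmerCongruentII, Appendix (Monsky), typescript p. 39 L27–L33] [cite: Cohen1993, §5.3.1 Algorithm 5.3.5] -/
theorem corner_p_nineteen (hmod : ModularForms.exists_isNewformOf) (hM : monsky_card_selmerGroup_two_odd)
    (hBT : burungaleTian_analyticRank_eq_zero_of_selmerCorank_eq_zero_of_hasCM) (hBF : bsdTriple_of_hasCM_of_L_one_ne_zero)
    {p : ℕ} [Fact p.Prime] [(congruentNumberCurve p).IsElliptic] [(congruentNumberCurve p).IsGloballyMinimal]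
    [NeZero ((congruentNumberCurve p).conductorNorm ℤ)] (hp8 : p % 8 = 7) (hJ : jacobiSym (p : ℤ) 19 = -1) :
    ∃ (K : Type) (_ : Field K) (_ : NumberField K),
      IsImaginaryQuadratic K ∧ 4 < (NumberField.discr K).natAbs ∧
      SatisfiesHeegnerHypothesis ((congruentNumberCurve p).conductorNorm ℤ) K ∧
      ((congruentNumberCurve p).quadraticTwist (NumberField.discr K : ℚ)).entireLFunction 1 ≠ 0 ∧
      NumberField.classNumber K < p ∧ ¬ p ∣ NumberField.classNumber K := by
  rcases Nat.lt_or_ge p 362 with hlt | hge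
  · obtain ⟨l, hlmem, -, hres, hh⟩ :=
      tableQ19 p (Finset.mem_range.mpr hlt) hp8 (forall_sq_ne_of_jacobiSym_eq_neg_one hJ)
    obtain ⟨hl, hl8⟩ := partnersL_spec l hlmem
    exact corner_p_partnerQ_row hmod hM hBT hBF (by norm_num) (by norm_num) hp8 hJ hl hl8 hres hh
  · exact corner_p_partnerQ hmod hM hBT hBF (q₀ := 19) (by norm_num) (by norm_num) (P := 362) (by norm_num) hp8 hJ hge

/-- **Rung `q₀ = 43`, `p ≠ 7`, four facts.** [cite: HeathBrown1994SelmerCongruentII, Appendix (Monsky), typescript p. 39 L27–L33] [cite: Cohen1993, §5.3.1 Algorithm 5.3.5] -/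
theorem corner_p_fortyThree (hmod : ModularForms.exists_isNewformOf) (hM : monsky_card_selmerGroup_two_odd)
    (hBT : burungaleTian_analyticRank_eq_zero_of_selmerCorank_eq_zero_of_hasCM) (hBF : bsdTriple_of_hasCM_of_L_one_ne_zero)
    {p : ℕ} [Fact p.Prime] [(congruentNumberCurve p).IsElliptic] [(congruentNumberCurve p).IsGloballyMinimal]
    [NeZero ((congruentNumberCurve p).conductorNorm ℤ)] (hp8 : p % 8 = 7) (hJ : jacobiSym (p : ℤ) 43 = -1) (h8 : 8 ≤ p) :
    ∃ (K : Type) (_ : Field K) (_ : NumberField K),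
      IsImaginaryQuadratic K ∧ 4 < (NumberField.discr K).natAbs ∧
      SatisfiesHeegnerHypothesis ((congruentNumberCurve p).conductorNorm ℤ) K ∧
      ((congruentNumberCurve p).quadraticTwist (NumberField.discr K : ℚ)).entireLFunction 1 ≠ 0 ∧
      NumberField.classNumber K < p ∧ ¬ p ∣ NumberField.classNumber K := by
  rcases Nat.lt_or_ge p 1409 with hlt | hge
  · obtain ⟨l, hlmem, -, hres, hh⟩ :=
      tableQ43 p (Finset.mem_range.mpr hlt) hp8 (forall_sq_ne_of_jacobiSym_eq_neg_one hJ) h8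
    obtain ⟨hl, hl8⟩ := partnersL_spec l hlmem
    exact corner_p_partnerQ_row hmod hM hBT hBF (by norm_num) (by norm_num) hp8 hJ hl hl8 hres hh
  · exact corner_p_partnerQ hmod hM hBT hBF (q₀ := 43) (by norm_num) (by norm_num) (P := 1409) (by norm_num) hp8 hJ hge

/-- **Rung `ℓ₀ = 13`, `p ≠ 7`, four facts.** [cite: HeathBrown1994SelmerCongruentII, Appendix (Monsky), typescript p. 39 L27–L33] [cite: Cohen1993, §5.3.1 Algorithm 5.3.5] -/
theorem corner_p_thirteen (hmod : ModularForms.exists_isNewformOf) (hM : monsky_card_selmerGroup_two_odd)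
    (hBT : burungaleTian_analyticRank_eq_zero_of_selmerCorank_eq_zero_of_hasCM) (hBF : bsdTriple_of_hasCM_of_L_one_ne_zero)
    {p : ℕ} [Fact p.Prime] [(congruentNumberCurve p).IsElliptic] [(congruentNumberCurve p).IsGloballyMinimal]
    [NeZero ((congruentNumberCurve p).conductorNorm ℤ)] (hp8 : p % 8 = 7) (hJ : jacobiSym (13 : ℤ) p = -1) (h8 : 8 ≤ p) :
    ∃ (K : Type) (_ : Field K) (_ : NumberField K),
      IsImaginaryQuadratic K ∧ 4 < (NumberField.discr K).natAbs ∧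
      SatisfiesHeegnerHypothesis ((congruentNumberCurve p).conductorNorm ℤ) K ∧
      ((congruentNumberCurve p).quadraticTwist (NumberField.discr K : ℚ)).entireLFunction 1 ≠ 0 ∧
      NumberField.classNumber K < p ∧ ¬ p ∣ NumberField.classNumber K := by
  have hJ' : jacobiSym ((13 : ℕ) : ℤ) p = -1 := by exact_mod_cast hJ
  have hres13 := forall_sq_ne_thirteen (by omega) hJ
  rcases Nat.lt_or_ge p 2805 with hlt | hge
  · obtain ⟨q, hqmem, -, hres, hh⟩ :
        ∃ q ∈ [3, 19, 11, 43, 59, 83, 107], q ≤ 10 * p ∧ (∀ x < q, x * x % q ≠ p % q) ∧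
          BinQF.classNumberCount (q * 13) < p := by
      rcases Nat.lt_or_ge p 1400 with h1400 | h1400
      · exact tableL13a p (Finset.mem_range.mpr h1400) hp8 hres13 h8
      · exact tableL13b p (Finset.mem_range.mpr hlt) h1400 hp8 hres13
    obtain ⟨hq, hq8⟩ := partnersQ_spec q hqmem
    exact corner_p_partnerL_row hmod hM hBT hBF (by norm_num) (by norm_num) hp8 hJ' hq hq8 hres hh
  · exact corner_p_partnerL hmod hM hBT hBF (ℓ₀ := 13) (by norm_num) (by norm_num) (P := 2805) (by norm_num) (by norm_num)
      hp8 hJ' hge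

/-- ★ **THE CORNER `W = E_p`, partners `{3, 5, 11, 13, 19, 43}`, FOUR NAMED FACTS**: for every prime `p ≡ 7 (mod 8)` with
`p ≡ 2 (mod 3)` or `p ≡ ±2 (mod 5)` or `(p/11) = −1` or `(p/19) = −1` or `(p/43) = −1` or `(13/p) = −1` — modulo Modularity (for
`N(E_p) = 32p²` only) + Monsky (odd) + Burungale–Tian + Burungale–Flach — a Heegner field `K′` of `N(E_p)` with `4 < |d_{K′}|`,
`L(E_p^{(d_{K′})}, 1) ≠ 0`, `h(K′) < p`, `p ∤ h(K′)` (p652497's `cruxOnEpCornerLadder_of_facts` without the Deuring–Hecke leaf).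
[cite: HeathBrown1994SelmerCongruentII, Appendix (Monsky), typescript p. 39 L27–L33] [cite: BurungaleTian2026, Thm. 1.1]
[cite: BurungaleFlach2024, Thm. 1.1 and Cor. 2] [cite: KoblitzECMF1993, Ch. II §5, Theorem (p. 84)] -/
theorem cruxOnEpCornerLadder_of_four_facts (hmod : ModularForms.exists_isNewformOf) (hM : monsky_card_selmerGroup_two_odd)
    (hBT : burungaleTian_analyticRank_eq_zero_of_selmerCorank_eq_zero_of_hasCM) (hBF : bsdTriple_of_hasCM_of_L_one_ne_zero)
    {p : ℕ} [Fact p.Prime] [(congruentNumberCurve p).IsElliptic] [(congruentNumberCurve p).IsGloballyMinimal]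
    [NeZero ((congruentNumberCurve p).conductorNorm ℤ)] (hp8 : p % 8 = 7)
    (hcase : p % 3 = 2 ∨ p % 5 = 2 ∨ p % 5 = 3 ∨ jacobiSym (p : ℤ) 11 = -1 ∨ jacobiSym (p : ℤ) 19 = -1 ∨
      jacobiSym (p : ℤ) 43 = -1 ∨ jacobiSym (13 : ℤ) p = -1) :
    ∃ (K : Type) (_ : Field K) (_ : NumberField K),
      IsImaginaryQuadratic K ∧ 4 < (NumberField.discr K).natAbs ∧
      SatisfiesHeegnerHypothesis ((congruentNumberCurve p).conductorNorm ℤ) K ∧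
      ((congruentNumberCurve p).quadraticTwist (NumberField.discr K : ℚ)).entireLFunction 1 ≠ 0 ∧
      NumberField.classNumber K < p ∧ ¬ p ∣ NumberField.classNumber K := by
  have hp : p.Prime := Fact.out
  by_cases h5 : p % 5 = 2 ∨ p % 5 = 3
  · exact corner_p_five hmod hM hBT hBF hp8 h5
  by_cases h3 : p % 3 = 2
  · exact corner_p_three hmod hM hBT hBF (by omega)
  have h8 : 8 ≤ p := by
    by_contra h
    have : p = 7 := by have := hp.two_le; omega
    exact h5 (Or.inl (by omega))
  have hrest : jacobiSym (p : ℤ) 11 = -1 ∨ jacobiSym (p : ℤ) 19 = -1 ∨ jacobiSym (p : ℤ) 43 = -1 ∨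
      jacobiSym (13 : ℤ) p = -1 := by tauto
  rcases hrest with h11 | h19 | h43 | h13
  · exact corner_p_eleven hmod hM hBT hBF hp8 h11
  · exact corner_p_nineteen hmod hM hBT hBF hp8 h19
  · exact corner_p_fortyThree hmod hM hBT hBF hp8 h43 h8
  · exact corner_p_thirteen hmod hM hBT hBF hp8 h13 h8


end Summit.BirchSwinnertonDyer.BirchSwinnertonDyer.Theorems.BiquadraticEisensteinDescentHeegnerTwistCouplingInSupplyCornersEpFourFacts
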